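import Literature.Computability.Cryptography.RegevReductionCVPLiftPost
import Literature.Algebra.EuclideanLattices.BabaiListMachine
import HarnessLib

/-!
# Regev 2009, Lemma 3.5 — the exact-`CVP` finish, PROVED (`A_fin` discharged; `A_lift` is a theorem)

Literature layer, sorry-free, on `{propext, Classical.choice, Quot.sound}`. HONEST FRAMING: the VALUE is a
THEOREM / DECIDABLE VERDICT / CERTIFICATE / precise negative result — NOT summit progress. Nothing in this
file bears on `BQP` vs `BPP`, on the hardness of `LWE`, or on any summit statement: it closes the last
CLASSICAL plumbing gap (Lemma 3.5's exact finish) of the tree's first formalisation of Regev's worst-case to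
average-case reduction (O. Regev, J. ACM 56(6), art. 34, 2009; lemma and page numbers as in the author's
version arXiv:2401.03703), and thereby shrinks the trust base of the tree's `pqc.S19` chain from
`{A_cvpq, A_lift, A_q14}` (`RegevReductionCVPSplit`, `RegevReductionCVPLiftPost`) to `{A_cvpq, A_q14}`.

## What is proved

* `Regev2009.LiftFinish.finishL_ofFn` — SEMANTICS of the finish program. For a nonsingular basis `B`, an
  LLL-reduced (`δ = 3/4`) basis `B'` of `L(B)`, `q ≥ 2` and admissible rational dual coordinates `t` of a
  query point at distance `d < λ₁(L(B)*)/2` from `L(B)*`, the integer-list program `finishL` run on the rows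
  of `B`, the rows of `B'` and the `2n`-th iterate `x_{2n}` of the digit peeling (`DigitOracle.iter`,
  `RegevReductionCVPSplit`) returns `(B^∨)^{-1} κ_{L*}(x_{2n})`, the dual coordinates of THE closest vector.
  The geometry is the tree's `Regev2009.coords_eq_of_isLLLReduced` (`RegevReductionCVPLiftExact`: after
  `2n` rounds the distance `d/q^{2n}` is below half of every Gram–Schmidt norm of the reversed dual basis
  of `B'`, so Babai's nearest plane is exact — Babai 1986 Thm. 3.1 with LLL82 Prop. 1.26); proved here is
  the exact integer bookkeeping: Cohen's integer inverse columns are `det² ·` the dual basis vectors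
  (`gcol_eq_smul_dualVec`), nearest-plane coefficients are invariant under a common non-zero scaling of
  basis and target (`nearestPlane_smul`, via `gramSchmidt_smul`), the common multiple
  `det(B)² · det(B')² · Π den(tⱼ)` makes rows and target integral, and `(B y)ⱼ = det(B')² · aⱼ`
  (`inner_coe_dualLattice`).
* `Regev2009.LiftFinish.bab_codeFP` — the program `bab : GapSVPInstance × List ℚ → List ℤ` is typed
  polynomial time (`CodeFP`), by composition of the tree's certified bricks only: instance rows
  (`GIVPPost.basisRows_codeFP`), the LLL machine (`GIVPPost.lllRows_codeFP`, `SimApproxLLL.lllOut`),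
  Cohen's integer inverse (`GSInverse.invData_codeFP`), Babai's integer nearest plane
  (`Babai.coeffsL_codeFP`), list algebra (`DualGrid.*_codeFP`), exact rationals (`CodeFPRat`), and the
  tree's fold for list products (`SimApproxLLL.prodFP`).
* `regev2009_lemma_3_5_finishFamily_holds : ∀ q, regev2009_lemma_3_5_finishFamily q` — the named fact
  `A_fin` of `RegevReductionCVPLiftPost` is a THEOREM (its hypotheses `q ∈ FP` and `q(n) ≥ 2` eventually
  are used only through `q(n) ≥ 2`).
* `regev2009_lemma_3_5_liftFamily_holds : ∀ q, regev2009_lemma_3_5_liftFamily q` — `A_lift` (Lemma 3.5: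
  a uniform quantum circuit family for `CVP^{(q)}` lifts to one for `CVP_{L*,d}`, `d < λ₁(L*)/2`, failure
  probability at most a linear union bound over the rounds plus a negligible term) is a THEOREM, by the
  tree's `regev2009_lemma_3_5_liftFamily_of_finishFamily`.
* Corollaries restating the tree's `pqc.S19` chain on the smaller trust base:
  `regev2009_lemma_3_4_cvpFamily_of_cvpq` (A_cvp ⇐ A_cvpq), `regev2009_lemma_3_3_stepMachine_of_cvpq_of_step`,
  `regev_lwe_to_sivp_quantum_holds_of_cvpq_of_step`, `regev_lwe_to_gapSVP_quantum_holds_of_cvpq_of_step`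
  (Regev's Theorem 1.1 in both forms from A_cvpq and A_q14 alone).

## What is NOT claimed

No statement about `LWE` hardness, lattice problems' complexity, or quantum advantage is proved or
weakened here; A_cvpq (Lemmas 3.7/3.11, the classical `CVP^{(q)}` solver built around the `LWE` oracle,
incl. the Gaussian-sample bookkeeping) and A_q14 (Lemma 3.14, the quantum step) remain NAMED FACTS used as
hypotheses. The finish criterion is the tree's (`2n` rounds and exactness of Babai on an LLL-reduced dual
basis, `RegevReductionCVPLiftExact`), which is Regev's "the distance … is smaller than … and hence we can
find the closest vector with, say, Babai's nearest plane algorithm" made quantitative; no other reading of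
Lemma 3.5's last sentence is formalised.

References: O. Regev, *On lattices, learning with errors, random linear codes, and cryptography*, J. ACM
56(6) (2009), Lemma 3.5 and §3.2.1; L. Babai, *On Lovász' lattice reduction and the nearest lattice point
problem*, Combinatorica 6 (1986), §3, Thm. 3.1; A. K. Lenstra, H. W. Lenstra, L. Lovász, Math. Ann. 261
(1982), Prop. 1.26; H. Cohen, *A Course in Computational Algebraic Number Theory* (1993), §2.6.3;
S. Arora, B. Barak, *Computational Complexity* (2009), §1.3.
-/

noncomputable section

namespace Literature.Computability.Cryptography

open Filter _root_.Computability Literature.Computability.Complexity Literature.Computability.Complexity.CodeFP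
open Literature.Computability.QuantumComplexity Literature.Algebra.EuclideanLattices
open Regev2009 Regev2009.DigitOracle Brick GSInverse DualGrid Babai GPVSampler Peikert2009 InnerProductSpace Finset
open scoped RealInnerProductSpace Matrix

namespace Regev2009

namespace LiftFinish

/-! ### Gram–Schmidt vectors and the nearest plane under a common scaling -/

section Scaling

variable {V : Type*} [NormedAddCommGroup V] [InnerProductSpace ℝ V]

/-- **Gram–Schmidt commutes with a common scaling**: `GS(c·f) = c · GS(f)` (`c ≠ 0`). [folklore] -/
theorem gramSchmidt_smul {ι : Type*} [LinearOrder ι] [LocallyFiniteOrderBot ι] [WellFoundedLT ι]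
    (f : ι → V) {c : ℝ} (hc : c ≠ 0) (n : ι) :
    gramSchmidt ℝ (c • f) n = c • gramSchmidt ℝ f n := by
  induction n using WellFoundedLT.induction with
  | ind n ih =>
    have h1 := gramSchmidt_def'' ℝ (c • f) n
    have h2 := gramSchmidt_def'' ℝ f n
    simp only [RCLike.ofReal_real_eq_id, id_eq, Pi.smul_apply] at h1 h2
    rw [eq_sub_of_add_eq h1.symm, eq_sub_of_add_eq h2.symm, smul_sub, Finset.smul_sum]
    congr 1
    refine Finset.sum_congr rfl fun i hi => ?_
    rw [ih i (Finset.mem_Iio.1 hi)]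
    by_cases hg : gramSchmidt ℝ f i = 0
    · simp [hg]
    · rw [real_inner_smul_left, real_inner_smul_right, norm_smul, mul_pow, Real.norm_eq_abs, sq_abs,
        smul_smul, smul_smul]
      congr 1
      have hn : ‖gramSchmidt ℝ f i‖ ^ 2 ≠ 0 := pow_ne_zero 2 (norm_ne_zero_iff.2 hg)
      field_simp

/-- The last centre is invariant under a common scaling. [folklore] -/
theorem lastCenter_smul {k : ℕ} (f : Fin (k + 1) → V) {c : ℝ} (hc : c ≠ 0) (x : V) :
    lastCenter (c • f) (c • x) = lastCenter f x := by
  rw [lastCenter, lastCenter, gramSchmidt_smul f hc]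
  by_cases hg : gramSchmidt ℝ f (Fin.last k) = 0
  · simp [hg]
  · rw [real_inner_smul_left, real_inner_smul_right, norm_smul, mul_pow, Real.norm_eq_abs, sq_abs]
    have hn : ‖gramSchmidt ℝ f (Fin.last k)‖ ^ 2 ≠ 0 := pow_ne_zero 2 (norm_ne_zero_iff.2 hg)
    field_simp

/-- **Babai's nearest plane is invariant under a common scaling of basis and target**:
`NearestPlane_{c·f}(c·x) = NearestPlane_f(x)` (`c ≠ 0`) — the coefficient vector only sees the ratios
`⟪x, f̃ᵢ⟫/‖f̃ᵢ‖²`. [cite: Babai1986, §3] -/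
theorem nearestPlane_smul : ∀ (k : ℕ) (f : Fin k → V) {c : ℝ} (_ : c ≠ 0) (x : V),
    nearestPlane k (c • f) (c • x) = nearestPlane k f x
  | 0, _, _, _, _ => funext fun i => i.elim0
  | k + 1, f, c, hc, x => by
      rw [nearestPlane_succ, nearestPlane_succ, lastCenter_smul f hc x, Pi.smul_apply,
        show c • x - (round (lastCenter f x) : ℝ) • c • f (Fin.last k) =
          c • (x - (round (lastCenter f x) : ℝ) • f (Fin.last k)) by rw [smul_sub, smul_comm],
        show (c • f) ∘ Fin.castSucc = c • (f ∘ Fin.castSucc) from rfl, nearestPlane_smul k _ hc]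

end Scaling

/-! ### Dual coordinates are inner products with the primal basis -/

section Dual

variable (J : LatticeInstance) [IsZLattice ℝ J.lattice]

/-- `⟪bᵢ, b^∨ⱼ⟫ = δᵢⱼ`. [cite: Peikert2009, §2.1] -/
theorem inner_vec_dualVec (i j : Fin J.n) : ⟪J.vec i, dualVec J j⟫ = if i = j then 1 else 0 := by
  simpa only [coe_zBasis, coe_dualZBasis] using inner_zBasis_dualZBasis J i j

/-- The coordinates of `x` in the dual basis are `⟪x, bᵢ⟫`. [folklore] -/
theorem dualVec_repr (x : EuclideanSpace ℝ (Fin J.n)) (i : Fin J.n) : (dualVec J).repr x i = ⟪x, J.vec i⟫ := by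
  classical
  rw [dualVec, LinearMap.BilinForm.dualBasis_repr_apply, LatticeInstance.coe_basisOfIsNonsingular]
  rfl

/-- A vector with `⟪x, bᵢ⟫ = δᵢₖ` is the dual vector `b^∨ₖ`. [folklore] -/
theorem eq_dualVec_of_inner {x : EuclideanSpace ℝ (Fin J.n)} {k : Fin J.n}
    (h : ∀ i, ⟪x, J.vec i⟫ = if i = k then 1 else 0) : x = dualVec J k := by
  classical
  rw [← (dualVec J).sum_repr x]
  simp_rw [dualVec_repr, h]
  simp [ite_smul, Finset.sum_ite_eq']

/-- **The dual coordinates of `v ∈ L(B)*` are `⟪v, bᵢ⟫`.** [cite: Regev2009, Lemma 3.4 ("L^{-1}κ_L(x)")] -/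
theorem inner_coe_dualLattice (v : dualLattice J.lattice) (i : Fin J.n) :
    ⟪(v : EuclideanSpace ℝ (Fin J.n)), J.vec i⟫ = ((dualZBasis J).repr v i : ℝ) := by
  classical
  have hv : (v : EuclideanSpace ℝ (Fin J.n)) = ∑ j, ((dualZBasis J).repr v j : ℝ) • dualVec J j := by
    conv_lhs => rw [← (dualZBasis J).sum_repr v]
    rw [Submodule.coe_sum]
    refine Finset.sum_congr rfl fun j _ => ?_
    rw [Submodule.coe_smul_of_tower, coe_dualZBasis, Int.cast_smul_eq_zsmul]
  have hb : ∀ j, ⟪dualVec J j, J.vec i⟫ = if i = j then 1 else 0 := fun j => by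
    rw [real_inner_comm]; exact inner_vec_dualVec J i j
  rw [hv, sum_inner]
  simp_rw [real_inner_smul_left, hb]
  simp [Finset.sum_ite_eq]

end Dual

/-! ### The columns of `det(T)² · T⁻¹` are `det(T)²` times the dual vectors -/

section Cols

variable (J : LatticeInstance)

/-- Column `k` of the integer matrix `invMatrix B = det(B)² · B⁻¹`, read in `ℝⁿ`. [cite: Cohen1993, §2.6.3] -/
def gcol (k : Fin J.n) : EuclideanSpace ℝ (Fin J.n) := intVecToEuclidean J.n fun t => invMatrix J.basis t k

/-- `⟪bᵢ, gₖ⟫ = det(B)² δᵢₖ`. [cite: Cohen1993, §2.6.3] -/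
theorem inner_vec_gcol (hJ : J.IsNonsingular) (i k : Fin J.n) :
    ⟪J.vec i, gcol J k⟫ = if i = k then (J.basis.det : ℝ) ^ 2 else 0 := by
  have h := congrFun (congrFun (mul_invMatrix hJ) i) k
  rw [Matrix.mul_apply, Matrix.smul_apply, Matrix.one_apply] at h
  have h' := congrArg (Int.cast : ℤ → ℝ) h
  push_cast at h'
  simp only [LatticeInstance.vec, gcol, PiLp.inner_apply, intVecToEuclidean_apply, RCLike.inner_apply,
    conj_trivial]
  rw [show ∑ t, (invMatrix J.basis t k : ℝ) * (J.basis i t : ℝ) = ∑ t, (J.basis i t : ℝ) * (invMatrix J.basis t k : ℝ)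
    from Finset.sum_congr rfl fun t _ => mul_comm _ _, h']
  split_ifs <;> simp

variable [IsZLattice ℝ J.lattice]

/-- **`b^∨ₖ = gₖ / det(B)²`**: the dual basis from the integer inverse. [cite: Cohen1993, §2.6.3; Peikert2009, §2.1] -/
theorem gcol_eq_smul_dualVec (k : Fin J.n) : gcol J k = ((J.basis.det : ℝ) ^ 2) • dualVec J k := by
  have hJ := isNonsingular_of_isZLattice J
  have hD : (J.basis.det : ℝ) ^ 2 ≠ 0 := pow_ne_zero 2 (by exact_mod_cast hJ)
  have h : ((J.basis.det : ℝ) ^ 2)⁻¹ • gcol J k = dualVec J k := by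
    refine eq_dualVec_of_inner J fun i => ?_
    rw [real_inner_smul_left, real_inner_comm, inner_vec_gcol J hJ]
    split_ifs <;> simp [hD]
  rw [← h, smul_smul, mul_inv_cancel₀ hD, one_smul]

end Cols

/-! ### List shapes -/

/-- The columns of the integer inverse of `rowsOf T` are the `ofFn` columns of `invMatrix T`. [folklore] -/
theorem invCols_rowsOf {n : ℕ} (T : Matrix (Fin n) (Fin n) ℤ) :
    invCols (rowsOf T) = List.ofFn fun k => vecL fun t => invMatrix T t k := by
  refine List.ext_getElem (by simp) fun k h1 h2 => ?_
  rw [getElem_invCols, List.getElem_ofFn]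
  refine list_eq_of_getD (n := n) (by simp) (by simp) fun t => ?_
  rw [getD_vecL, invMatrix_apply]

/-- The reversed columns of the integer inverse of `rowsOf T` (column `n-1-i` of `invMatrix T` at place
`i`). [folklore] -/
theorem reverse_invCols_rowsOf {n : ℕ} (T : Matrix (Fin n) (Fin n) ℤ) :
    (invCols (rowsOf T)).reverse = List.ofFn fun i => vecL fun t => invMatrix T t (Fin.rev i) := by
  have hrev : ∀ {α : Type} (f : Fin n → α), (List.ofFn f).reverse = List.ofFn fun i => f (Fin.rev i) :=
    fun f => by
      refine List.ext_getElem (by simp) fun i h1 h2 => ?_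
      simp only [List.getElem_reverse, List.getElem_ofFn, List.length_ofFn]
      congr 1
      ext
      simp only [Fin.val_rev]
      have : i < n := by simpa using h2
      omega
  rw [invCols_rowsOf, hrev]


/-! ### The finish program on integer lists -/

/-- The integer multiples `N_j = D_t · t_j` of the input rationals, `D_t` the product of their
denominators. [folklore] -/
def numL (L : List ℚ) : List ℤ := L.map fun x => ((((L.map Rat.den).prod : ℕ) : ℚ) * x).num

/-- **The exact finish on lists** (`rows` = the basis `B`, `rows'` = an LLL-reduced basis `B'` of `L(B)`,
`L` = the rational dual coordinates `t` of the query point `x = Σ tⱼ b^∨ⱼ`): with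
`(D, [g_k]) = invData rows` (`B [g_k] = D·I`), `(D', [g'_k]) = invData rows'`, `D_t = Π den tⱼ`, the rows
`F_i = D·D_t·g'_{n-1-i}` and the target `W = D'·Σⱼ (D_t tⱼ) gⱼ` are `D D' D_t` times the reversed dual basis
of `B'` and the point `x`; Babai's coefficients `z = coeffsL F W` are those of `x` in the reversed dual basis
(common scaling); the output is `aⱼ = ⟪bⱼ, Σᵢ zᵢ b'^∨_{n-1-i}⟫ = (B · Σᵢ zᵢ g'_{n-1-i})ⱼ / D'`.
[cite: Regev2009, Lemma 3.5 (proof: "we use … Babai's nearest plane algorithm"); Babai1986, §3; Cohen1993, §2.6.3] -/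
def finishL (rows rows' : List (List ℤ)) (L : List ℚ) : List ℤ :=
  edivL (mulVecL rows
    (colCombL rows.length (invCols rows').reverse
      (coeffsL (((invCols rows').reverse).map (smulL (invDen rows * ((L.map Rat.den).prod : ℕ))))
        (smulL (invDen rows') (colCombL rows.length (invCols rows) (numL L))))))
    (invDen rows')

/-- `D_t · t` is an integer when `den t ∣ D_t`. [folklore] -/
theorem cast_num_natCast_mul {D : ℕ} {t : ℚ} (h : t.den ∣ D) : ((((D : ℚ) * t).num : ℤ) : ℚ) = (D : ℚ) * t := by
  obtain ⟨k, hk⟩ := h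
  have ht : (D : ℚ) * t = ((k * t.num : ℤ) : ℚ) := by
    rw [hk]
    push_cast
    rw [← Rat.den_mul_eq_num t]
    ring
  rw [ht, Rat.num_intCast]

/-- The integer vector `Σⱼ Nⱼ · (column j of G)`, read in `ℝⁿ`. [folklore] -/
theorem intVecToEuclidean_mulVec (J : LatticeInstance) (N : Fin J.n → ℤ) :
    intVecToEuclidean J.n (invMatrix J.basis *ᵥ N) = ∑ j, (N j : ℝ) • gcol J j := by
  ext t
  simp [gcol, Matrix.mulVec, dotProduct, Finset.sum_apply, mul_comm]

/-- The integer vector `Σᵢ zᵢ · (column (rev i) of G)`, read in `ℝⁿ`. [folklore] -/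
theorem intVecToEuclidean_sum_rev (J : LatticeInstance) (z : Fin J.n → ℤ) :
    intVecToEuclidean J.n (fun t => ∑ i, z i * invMatrix J.basis t (Fin.rev i)) = ∑ i, (z i : ℝ) • gcol J (Fin.rev i) := by
  ext t
  simp [gcol, Finset.sum_apply]

/-- `(B y)ⱼ = ⟪bⱼ, y⟫` for integer vectors. [folklore] -/
theorem cast_mulVec_eq_inner (J : LatticeInstance) (y : Fin J.n → ℤ) (j : Fin J.n) :
    ((J.basis *ᵥ y) j : ℝ) = ⟪J.vec j, intVecToEuclidean J.n y⟫ := by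
  simp [Matrix.mulVec, dotProduct, LatticeInstance.vec, PiLp.inner_apply, mul_comm]

section Semantics

variable (q : ℕ) [NeZero q] (I : LatticeInstance) [IsZLattice ℝ I.lattice] (B' : Matrix (Fin I.n) (Fin I.n) ℤ)

/-- **The finish program is correct** (Lemma 3.5's last step on exact data): for an LLL-reduced basis `B'`
of `L(B)`, `q ≥ 2` and admissible rational data `t` at distance `d < λ₁(L(B)*)/2`, on the rows of `B`, the
rows of `B'` and the list of the `2n`-th iterate `x_{2n}` the program returns the dual coordinate vector
`a(x_{2n}) = (B^∨)^{-1} κ_{L*}(x_{2n})`. [cite: Regev2009, Lemma 3.5 (proof); Babai1986, Thm. 3.1; Cohen1993, §2.6.3] -/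
theorem finishL_ofFn (hBL : (⟨I.n, B'⟩ : LatticeInstance).lattice = I.lattice)
    (hBred : IsLLLReduced (3 / 4) (⟨I.n, B'⟩ : LatticeInstance).vec) (hq : 2 ≤ q)
    {t : Fin I.n → ℚ} {d : ℝ} (hd : d < minNorm (dualLattice I.lattice) / 2) (ht : Admissible I d t) :
    finishL (rowsOf I.basis) (rowsOf B') (List.ofFn (iter q I t (2 * I.n))) =
      List.ofFn (CVPOracle.coords I (point I (iter q I t (2 * I.n)))) := by
  classical
  -- names
  have hI : I.IsNonsingular := isNonsingular_of_isZLattice I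
  let J : LatticeInstance := ⟨I.n, B'⟩
  have hJ : J.IsNonsingular := LatticeInstance.isNonsingular_of_lattice_eq hI hBL
  haveI : IsZLattice ℝ J.lattice := J.isZLattice_of_isNonsingular hJ
  have hdetI : I.basis.det ≠ 0 := hI
  have hdetJ : B'.det ≠ 0 := hJ
  set t' : Fin I.n → ℚ := iter q I t (2 * I.n) with ht'
  let T := I.basis
  let G := invMatrix T
  let G' := invMatrix B'
  let D : ℤ := T.det ^ 2
  let D' : ℤ := B'.det ^ 2
  let Dt : ℕ := ((List.ofFn t').map Rat.den).prod
  let N : Fin I.n → ℤ := fun j => (((Dt : ℕ) : ℚ) * t' j).num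
  let cF : ℤ := D * (Dt : ℤ)
  let F : Fin I.n → Fin I.n → ℤ := fun i => cF • fun s => G' s (Fin.rev i)
  let Wv : Fin I.n → ℤ := D' • (G *ᵥ N)
  let z : Fin I.n → ℤ := intNearestPlane I.n F Wv
  let yv : Fin I.n → ℤ := fun s => ∑ i, z i * G' s (Fin.rev i)
  -- positivity / non-vanishing
  have hDt : 0 < Dt := List.prod_pos fun x hx => by
    obtain ⟨r, -, rfl⟩ := List.mem_map.1 hx
    exact r.den_pos
  have hDne : (D : ℝ) ≠ 0 := by
    have : D ≠ 0 := pow_ne_zero 2 hdetI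
    exact_mod_cast this
  have hD'ne : D' ≠ 0 := pow_ne_zero 2 hdetJ
  have hD'neR : (D' : ℝ) ≠ 0 := by exact_mod_cast hD'ne
  have hcF : (cF : ℝ) ≠ 0 := by
    have : (cF : ℝ) = (D : ℝ) * (Dt : ℝ) := by push_cast [cF]; ring
    rw [this]
    exact mul_ne_zero hDne (by exact_mod_cast hDt.ne')
  -- (1) list shapes: the program computes `vecL (fun j => (T yv)ⱼ / D')`
  have hlen : (rowsOf T).length = I.n := length_rowsOf T
  have hDI : invDen (rowsOf T) = D := invDen_eq_det_sq hdetI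
  have hDJ : invDen (rowsOf B') = D' := invDen_eq_det_sq hdetJ
  have hcolsJ : (invCols (rowsOf B')).reverse = List.ofFn fun i => vecL fun s => G' s (Fin.rev i) :=
    reverse_invCols_rowsOf B'
  have hN : numL (List.ofFn t') = vecL N := by
    rw [numL, List.map_ofFn]; rfl
  have hW : smulL D' (colCombL I.n (invCols (rowsOf T)) (vecL N)) = vecL Wv := by
    rw [colCombL_invCols T N, smulL_vecL]
  have hFr : ((invCols (rowsOf B')).reverse).map (smulL cF) = List.ofFn fun i => List.ofFn (F i) := by
    rw [hcolsJ, List.map_ofFn]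
    exact congrArg List.ofFn (funext fun i => by rw [Function.comp_apply, smulL_vecL]; rfl)
  -- (2) the rows `F` are `λ` times the reversed dual basis of `B'`, `λ = D·D_t·D'`
  let f : Fin I.n → EuclideanSpace ℝ (Fin I.n) := ⇑(dualVec J) ∘ Fin.rev
  let lam : ℝ := (cF : ℝ) * (D' : ℝ)
  have hlam : lam ≠ 0 := mul_ne_zero hcF hD'neR
  have hgJ : ∀ k, gcol J k = (D' : ℝ) • dualVec J k := fun k => by
    rw [gcol_eq_smul_dualVec J k]; congr 1; push_cast [D']; rfl
  have hgI : ∀ j, gcol I j = (D : ℝ) • dualVec I j := fun j => by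
    rw [gcol_eq_smul_dualVec I j]; congr 1; push_cast [D]; rfl
  have hF : rowsR F = lam • f := by
    funext i
    show intVecToEuclidean I.n (cF • fun s => G' s (Fin.rev i)) = lam • (dualVec J (Fin.rev i))
    rw [map_zsmul, ← Int.cast_smul_eq_zsmul ℝ, show intVecToEuclidean I.n (fun s => G' s (Fin.rev i)) = gcol J (Fin.rev i) from rfl,
      hgJ, smul_smul]
  have hli : LinearIndependent ℝ (rowsR F) := by
    rw [hF]
    have h0 : LinearIndependent ℝ f := (dualVec J).linearIndependent.comp Fin.rev Fin.rev_injective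
    have h1 := h0.units_smul fun _ => Units.mk0 lam hlam
    have h2 : lam • f = (fun _ : Fin I.n => Units.mk0 lam hlam) • f := by
      funext i; simp [Units.smul_def]
    rw [h2]; exact h1
  -- (3) the target `W` is `λ` times the query point
  have hNcast : ∀ j, ((N j : ℤ) : ℝ) = (Dt : ℝ) * ((t' j : ℚ) : ℝ) := fun j => by
    have hdvd : (t' j).den ∣ Dt := List.dvd_prod (List.mem_map.2 ⟨t' j, by simp, rfl⟩)
    have h := cast_num_natCast_mul hdvd
    have h' := congrArg (Rat.cast : ℚ → ℝ) h
    push_cast at h'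
    exact h'
  have hWreal : intVecToEuclidean I.n Wv = lam • point I t' := by
    show intVecToEuclidean I.n (D' • (G *ᵥ N)) = lam • point I t'
    rw [map_zsmul, ← Int.cast_smul_eq_zsmul ℝ, intVecToEuclidean_mulVec I N, point_eq]
    simp_rw [hNcast, hgI, Finset.smul_sum, smul_smul]
    refine Finset.sum_congr rfl fun j _ => ?_
    congr 1
    simp only [lam, cF]
    push_cast
    ring
  -- (4) Babai's coefficients of the program are those of `x_{2n}` in the reversed dual basis
  have hz : z = nearestPlane I.n f (point I t') := by
    show intNearestPlane I.n F Wv = _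
    rw [intNearestPlane_eq I.n F hli Wv, hF, hWreal, nearestPlane_smul I.n f hlam]
  have hzL : coeffsL (List.ofFn fun i => List.ofFn (F i)) (vecL Wv) = List.ofFn z := coeffsL_ofFn F Wv hli
  -- (5) the output vector `y = Σ zᵢ g'_{rev i} = D' · (Babai's vector)`
  have hy : colCombL I.n (invCols (rowsOf B')).reverse (List.ofFn z) = vecL yv := by
    rw [hcolsJ]; exact colCombL_ofFn (fun i s => G' s (Fin.rev i)) z
  have hyreal : intVecToEuclidean I.n yv = (D' : ℝ) • vecOf f z := by
    show intVecToEuclidean I.n (fun s => ∑ i, z i * G' s (Fin.rev i)) = _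
    rw [intVecToEuclidean_sum_rev J z, vecOf, Finset.smul_sum]
    refine Finset.sum_congr rfl fun i _ => ?_
    rw [hgJ, smul_smul, smul_smul, mul_comm]; rfl
  -- (6) the dual coordinates of the last iterate are those of Babai's vector
  have hmem : vecOf f z ∈ dualLattice I.lattice := by
    rw [← span_dualVec_rev_eq I B' hBL]; exact vecOf_mem_span _ _
  have hcoords : ∀ j, CVPOracle.coords I (point I t') j = (dualZBasis I).repr ⟨vecOf f z, hmem⟩ j := fun j => by
    have h1 := coords_eq_of_isLLLReduced q I B' hBL hBred hq hd ht j
    have h2 := coords_eq_pow_mul_coords_iter_add_sum q I hd ht j (2 * I.n)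
    have hq0 : ((q : ℤ)) ^ (2 * I.n) ≠ 0 := pow_ne_zero _ (by exact_mod_cast NeZero.ne q)
    have h3 := mul_left_cancel₀ hq0 (add_right_cancel (h2.symm.trans h1))
    rw [h3]
    simp only [hz]
    rfl
  -- (7) `(B y)ⱼ = D' · aⱼ`
  have hTy : ∀ j, (T *ᵥ yv) j = D' * CVPOracle.coords I (point I t') j := fun j => by
    have h : ((T *ᵥ yv) j : ℝ) = (D' : ℝ) * (CVPOracle.coords I (point I t') j : ℝ) := by
      rw [cast_mulVec_eq_inner I yv j, hyreal, real_inner_smul_right, real_inner_comm,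
        show ⟪vecOf f z, I.vec j⟫ = ⟪((⟨vecOf f z, hmem⟩ : dualLattice I.lattice) : EuclideanSpace ℝ (Fin I.n)), I.vec j⟫ from rfl,
        inner_coe_dualLattice I ⟨vecOf f z, hmem⟩ j, hcoords j]
    exact_mod_cast h
  -- assemble
  have hout : edivL (mulVecL (rowsOf T) (vecL yv)) D' = List.ofFn (CVPOracle.coords I (point I t')) := by
    rw [mulVecL_rowsOf, edivL_vecL]
    exact congrArg List.ofFn (funext fun j => by rw [hTy j, Int.mul_ediv_cancel_left _ hD'ne])
  show finishL (rowsOf T) (rowsOf B') (List.ofFn t') = _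
  rw [finishL, hlen, hDI, hDJ, hN, hW, hFr, show (vecL Wv) = vecL Wv from rfl, hzL, hy, hout]

end Semantics

/-! ### The finish program is typed polynomial time -/

section Machine

/-- The integer multiples `numL` on codes. [cite: AroraBarak2009, §1.3] -/
theorem numL_codeFP : CodeFP (rawE encodeRat) (rawE intE) numL := by
  have hDt : CodeFP (rawE encodeRat) natE (fun L => (L.map Rat.den).prod) :=
    (SimApproxLLL.prodFP.comp (map₀ ratNumDen.snd') :)
  have hq : CodeFP (pairE natE encodeRat) encodeRat (fun t => ((t.1 : ℤ) : ℚ) / ((1 : ℕ) : ℚ)) :=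
    (ratOfIntNat.comp ((intOfNat.comp (fst _ _)).pair (const _ (1 : ℕ))) :)
  have hmul : CodeFP (pairE natE encodeRat) intE (fun t => (((t.1 : ℕ) : ℚ) * t.2).num) :=
    (ratNumDen.comp (ratMul.comp (hq.pair (snd _ _)))).fst'.congr fun t => by simp
  have h := ((map hmul).comp (hDt.pair (CodeFP.id _)) :)
  exact h.congr fun L => rfl

/-- The lattice instance off the `GapSVP` instance code. [cite: MicciancioGoldwasser2002, Ch. 1 §1.2] -/
theorem svpInst_codeFP : CodeFP GapSVPInstance.encode LatticeInstance.encode (fun p : GapSVPInstance => p.1) := by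
  obtain ⟨F, hF, h⟩ := CodeFP.fst LatticeInstance.encode (pairE smE natE)
  exact ⟨F, hF, fun p => by obtain ⟨I, r⟩ := p; exact h (I, (r.num, r.den))⟩

/-- **The finish program of `A_fin`**: on `((B, ρ), t)` run `finishL` on the rows of `B`, the rows of the
tree's LLL basis `lllOut B` of `L(B)` (LLL82 Prop. 1.26, `SimApproxLLL.lllOut_spec`) and `t`.
[cite: Regev2009, Lemma 3.5 (proof); LenstraLenstraLovasz1982, Prop. 1.26; Babai1986, §3] -/
def bab (p : GapSVPInstance × List ℚ) : List ℤ :=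
  finishL (rowsOf p.1.1.basis) (rowsOf (SimApproxLLL.lllOut p.1.1).basis) p.2

/-- The argument code of the finish. [folklore] -/
abbrev inE : GapSVPInstance × List ℚ → List Bool := pairE GapSVPInstance.encode (listE encodeRat)

/-- **The finish program is typed polynomial time** (composition of the tree's certified bricks: instance
rows, the LLL machine, Cohen's integer inverse, Babai's integer nearest plane, list algebra, exact rational
arithmetic). [cite: AroraBarak2009, §1.3; LenstraLenstraLovasz1982, Prop. 1.26; Babai1986, §3; Cohen1993, §2.6.3 and Algorithm 2.6.7] -/
theorem bab_codeFP : CodeFP inE (rawE intE) bab := by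
  have hI : CodeFP inE LatticeInstance.encode (fun p => p.1.1) := (svpInst_codeFP.comp (fst _ _) :)
  have hrows : CodeFP inE rowsE (fun p => rowsOf p.1.1.basis) := (GIVPPost.basisRows_codeFP.comp hI :)
  have hrows' : CodeFP inE rowsE (fun p => rowsOf (SimApproxLLL.lllOut p.1.1).basis) :=
    (GIVPPost.lllRows_codeFP.comp hI :)
  have hL : CodeFP inE (rawE encodeRat) (fun p => p.2) := ((rawOfList encodeRat).comp (snd _ _) :)
  have hn : CodeFP inE unE (fun p => (rowsOf p.1.1.basis).length) := ((ulength _).comp hrows :)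
  have hdI : CodeFP inE (pairE intE rowsE) (fun p => (invDen (rowsOf p.1.1.basis), invCols (rowsOf p.1.1.basis))) :=
    (invData_codeFP.comp hrows :)
  have hdJ : CodeFP inE (pairE intE rowsE) (fun p => (invDen (rowsOf (SimApproxLLL.lllOut p.1.1).basis),
      invCols (rowsOf (SimApproxLLL.lllOut p.1.1).basis))) := (invData_codeFP.comp hrows' :)
  have hDt : CodeFP inE natE (fun p => (p.2.map Rat.den).prod) := (SimApproxLLL.prodFP.comp ((map₀ ratNumDen.snd').comp hL) :)
  have hNL : CodeFP inE (rawE intE) (fun p => numL p.2) := (numL_codeFP.comp hL :)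
  have hW : CodeFP inE (rawE intE) (fun p => smulL (invDen (rowsOf (SimApproxLLL.lllOut p.1.1).basis))
      (colCombL (rowsOf p.1.1.basis).length (invCols (rowsOf p.1.1.basis)) (numL p.2))) :=
    (smulL_codeFP.comp (hdJ.fst'.pair (colCombL_codeFP.comp (hn.pair (hdI.snd'.pair hNL)))) :)
  have hc : CodeFP inE intE (fun p => invDen (rowsOf p.1.1.basis) * ((p.2.map Rat.den).prod : ℕ)) :=
    (intMul.comp (hdI.fst'.pair (intOfNat.comp hDt)) :)
  have hrev : CodeFP inE rowsE (fun p => (invCols (rowsOf (SimApproxLLL.lllOut p.1.1).basis)).reverse) :=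
    ((rawReverse (rawE intE)).comp hdJ.snd' :)
  have hFr : CodeFP inE rowsE (fun p => ((invCols (rowsOf (SimApproxLLL.lllOut p.1.1).basis)).reverse).map
      (smulL (invDen (rowsOf p.1.1.basis) * ((p.2.map Rat.den).prod : ℕ)))) :=
    ((map smulL_codeFP).comp (hc.pair hrev) :)
  have hz := (coeffsL_codeFP.comp (hFr.pair hW) :)
  have hy := (colCombL_codeFP.comp (hn.pair (hrev.pair hz)) :)
  have hout := (edivL_codeFP.comp ((mulVecL_codeFP.comp (hrows.pair hy)).pair hdJ.fst') :)
  exact hout.congr fun p => rfl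

end Machine

end LiftFinish

end Regev2009

/-! ### `A_fin` discharged; `A_lift` is a theorem -/

open Regev2009.LiftFinish in
/-- **`A_fin` holds** (`regev2009_lemma_3_5_finishFamily`, Regev 2009 Lemma 3.5's exact-`CVP` finish as
a typed polynomial-time program): the program `LiftFinish.bab` — LLL on `B` (LLL82 Prop. 1.26), Cohen's
integer inverses of `B` and of the reduced basis `B'` (the dual bases times `det²`), Babai's integer
nearest plane on the common multiple `det(B)² det(B')² Π den(tⱼ)` of the reversed dual basis of `B'` and
of the query point `x_{2n} = Σ tⱼ b^∨ⱼ`, and the dual coordinates `aⱼ = ⟪bⱼ, v⟫` of Babai's vector `v` by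
exact division — is in `FP` (`bab_codeFP`) and returns `(B^∨)^{-1} κ_{L*}(x_{2n})` on the `2n`-th iterate
of admissible data (`finishL_ofFn`, from `coords_eq_of_isLLLReduced`: after `2n` rounds the distance
`d/q^{2n}` is below half of every Gram–Schmidt norm of the reversed dual of an LLL-reduced basis, so Babai's
algorithm returns THE closest vector, Babai 1986 Thm. 3.1). The hypotheses `q ∈ FP` and `q(n) ≥ 2`
eventually of the named fact are used only through `q(n) ≥ 2` (`q(n) ≠ 0` and Lemma 3.5's finish
criterion). [cite: Regev2009, Lemma 3.5 (proof); Babai1986, §3 and Thm. 3.1; LenstraLenstraLovasz1982, Prop. 1.26; Cohen1993, §2.6.3] -/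
theorem regev2009_lemma_3_5_finishFamily_holds : ∀ q : ℕ → ℕ, regev2009_lemma_3_5_finishFamily q := by
  intro q _ hq2
  refine ⟨bab, bab_codeFP, ?_⟩
  filter_upwards [hq2] with n hn I ρ hIn hI d hd c hc
  subst hIn
  haveI : NeZero (q I.n) := ⟨by omega⟩
  haveI := I.isZLattice_of_isNonsingular hI
  obtain ⟨hBL, hBred⟩ := SimApproxLLL.lllOut_spec hI
  exact finishL_ofFn (q I.n) I (SimApproxLLL.lllOut I).basis hBL hBred hn hd (admissible_ratOf I hc)

/-- **`A_lift` is a theorem** (`regev2009_lemma_3_5_liftFamily q` for every `q ∈ FP` with `q(n) ≥ 2`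
eventually — the hypotheses are inside the named fact): Regev 2009 Lemma 3.5, the classical lifting of a
`CVP^{(q)}` circuit family to a `CVP_{L*}` family, from `A_fin → A_lift`
(`regev2009_lemma_3_5_liftFamily_of_finishFamily`, tree) and `A_fin` (above). The trust base of the tree's
`pqc.S19` chain (`RegevReductionCVPSplit.lean`) is thereby `{A_cvpq, A_q14}`.
[cite: Regev2009, Lemma 3.5; Babai1986, Thm. 3.1; LenstraLenstraLovasz1982, Prop. 1.26] -/
theorem regev2009_lemma_3_5_liftFamily_holds : ∀ q : ℕ → ℕ, regev2009_lemma_3_5_liftFamily q :=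
  fun q => regev2009_lemma_3_5_liftFamily_of_finishFamily (regev2009_lemma_3_5_finishFamily_holds q)

/-- **A_cvp from A_cvpq alone** (Regev 2009 Lemma 3.4's solver family for `CVP_{L*, αq/(√2 r)}` from the
`CVP^{(q)}` family of Lemmas 3.7/3.11): `regev2009_lemma_3_4_cvpFamily_of_cvpq_of_lift` with `A_lift` now a
theorem. [cite: Regev2009, §3.2.1 (p. 16: proof of Lemma 3.4 from Lemmas 3.5, 3.7, 3.11)] -/
theorem regev2009_lemma_3_4_cvpFamily_of_cvpq (q : ℕ → ℕ) [∀ n, NeZero (q n)] (α : ℕ → ℝ)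
    (hT : regev2009_lemma_3_11_cvpqFamily q α) : regev2009_lemma_3_4_cvpFamily q α :=
  regev2009_lemma_3_4_cvpFamily_of_cvpq_of_lift q α hT (regev2009_lemma_3_5_liftFamily_holds q)

/-- **A_step from A_cvpq and A_q14** (the iterative-step machine of Lemma 3.3).
[cite: Regev2009, Lemma 3.3 (proof, p. 15), Lemmas 3.4, 3.5, 3.7, 3.11, 3.14] -/
theorem regev2009_lemma_3_3_stepMachine_of_cvpq_of_step (q : ℕ → ℕ) [∀ n, NeZero (q n)] (α : ℕ → ℝ)
    (hT : regev2009_lemma_3_11_cvpqFamily q α) (hQ : regev2009_lemma_3_14_stepFamily q α) :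
    regev2009_lemma_3_3_stepMachine q α :=
  regev2009_lemma_3_3_stepMachine_of_cvpq_of_lift_of_step q α hT (regev2009_lemma_3_5_liftFamily_holds q) hQ

/-- **`pqc.S19` as filed (Regev's Theorem 1.1, `SIVP` form) from the TWO residual named facts A_cvpq
(Lemmas 3.7/3.11: the classical `CVP^{(q)}` solver around the `LWE` oracle) and A_q14 (Lemma 3.14: the
quantum step) alone** — Lemma 3.5 (A_lift) being a theorem of this file and every other step of Regev's §3 a
theorem of the tree. This is a statement about the TRUST BASE of a formalisation, not a new reduction.
[cite: Regev2009, Theorem 1.1, Theorem 3.1, Lemma 3.3, Lemma 3.4, Lemma 3.5, Lemma 3.14, Lemma 3.17] -/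
theorem regev_lwe_to_sivp_quantum_holds_of_cvpq_of_step (q : ℕ → ℕ) [∀ n, NeZero (q n)] (α : ℕ → ℝ) (m : ℕ → ℕ)
    (hT : regev2009_lemma_3_11_cvpqFamily q α) (hQ : regev2009_lemma_3_14_stepFamily q α) :
    regev_lwe_to_sivp_quantum q α m :=
  regev_lwe_to_sivp_quantum_holds_of_cvpq_of_lift_of_step q α m hT (regev2009_lemma_3_5_liftFamily_holds q) hQ

/-- **Regev's Theorem 1.1, `GapSVP` form, from A_cvpq and A_q14 alone.**
[cite: Regev2009, Theorem 1.1, Theorem 3.1, Lemma 3.3, Lemma 3.4, Lemma 3.5, Lemma 3.14, Lemma 3.20] -/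
theorem regev_lwe_to_gapSVP_quantum_holds_of_cvpq_of_step (q : ℕ → ℕ) [∀ n, NeZero (q n)] (α : ℕ → ℝ) (m : ℕ → ℕ)
    (hT : regev2009_lemma_3_11_cvpqFamily q α) (hQ : regev2009_lemma_3_14_stepFamily q α) :
    regev_lwe_to_gapSVP_quantum q α m :=
  regev_lwe_to_gapSVP_quantum_holds_of_cvpq_of_lift_of_step q α m hT (regev2009_lemma_3_5_liftFamily_holds q) hQ

end Literature.Computability.Cryptography

end
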